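import Summits.AtomisticToContinuum.Crystallization.Theorems.ChartedZeroExcessLayeredLatticeLiouvilleYJC

/-!
# Charted zero-excess layered-lattice Liouville — YK «FreeCoreCriticality»: the mild core is itself clamped-critical (PROVED); the doubly-critical near floor (lens-2 g66, addendum)

Addendum to node g66 «SecantLadder + NearFarShellSplit» (docket `stmt-AtomisticToContinuum-26636`), answering CRITIC-LEDGER row 1208 (b⁗)(ii) — the CLASS-WIDTH
FLAG on (QSⁿ)/(QH): «no criticality / local minimality of `xf` is among the binders … state whether criticality of the configuration `S` itself on its core is
available in the docket's context and can be threaded into (QSⁿ)/(QH) at no cost».  IT IS, AND IT IS ALREADY THERE: the door predicate `IsDoorSetP aHi δ S` carries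
single-site Nash stationarity `IsNash (μS S)` and `δ`-separation, and the core `range xf = coreOf S K ρ` lies in `S`; hence (this file, PROVED, no certificate)
every injectively enumerated finite region of `S` — in particular the mild core `xf` — is a CRITICAL POINT of its clamped energy against the rest of `S`.
Imports part YJ-C only (tree vocabulary + the ladder's (QSⁿ)/(QH)); lands any time after YJ-C.

* **YK-1 FREE CRITICALITY (PROVED)**: `hasFDerivAt_clampedEnergy_zero_of_isNash` — for `δ`-separated single-site-Nash `S` with summable pair sums and an injective
  `xf` with `range xf ⊆ S`: `HasFDerivAt (clampedEnergy (S ∖ range xf)) 0 xf`.  Differentiability: the clamped energy is `½ΣⱼΣₖ V(dist (z j) (z k)) + Σⱼ Σ'_{y ∈ S ∖ range xf}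
  V(dist (z j) y)`; pair terms by N-force-balance's `hasFDerivAt_pair`, the exterior sums by its `hasFDerivAt_siteEnergy` (the full site sum over `S ∖ {xf j}`,
  `summable_inv_pow_six`) minus the finitely many family terms (`tsum_sdiff_singleton_eq_add`, part UH's set dictionary `tsum_nash_eq`).  Vanishing: displacing ONE
  member changes the clamped energy by the change of its site sum over `S ∖ {xf i}` (`clampedEnergy_update_eq`), which N's inequality makes locally minimal at `xf i`
  (`isLocalMin_clampedEnergy_update`); `IsLocalMin.hasFDerivAt_eq_zero` on `x ↦ update xf i x` (`hasFDerivAt_update`) kills the derivative on every coordinate direction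
  `Pi.single i u`, and these span (`Finset.univ_sum_single`).  Docket form `hasFDerivAt_clampedEnergy_core` (binders `IsDoorSetP`, summability, `range xf = coreOf S K ρ`).
* **YK-2 THE DOUBLY-CRITICAL NEAR FLOOR**: (QSⁿᶜ) `NearSecantFloorCritP` and (QHᶜ) `NearHessianFloorCritP` = (QSⁿ)/(QH) of part YJ-C VERBATIM with ONE extra binder, the
  clamped criticality of the CORE `xf`; `(QSⁿᶜ) ⇒ (QSⁿ)`, `(QHᶜ) ⇒ (QH)`, `(QHᶜ) ⇒ (QSⁿ)` PROVED by YK-1, and `(QSⁿ) ⇒ (QSⁿᶜ)` trivially — the statements are EQUIVALENT;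
  the typed class of the near-floor certificate is therefore that of segments joining TWO nearby clamped-critical configurations (a Nash-relaxed `ϑp`-tame core and
  its tame critical filling), not the full tolerance class of `ϑp`-tame enumerations: row 1208's consequence (i) is answered («perturbative about RELAXED cores» is
  the admissible certificate design) and its census amendment ADV-QH should sample NASH-RELAXED class members (homogeneous strains to the tameness limit are Nash in
  the bulk; few-site displacements and random tame fields enter only through their sitewise relaxations).
-/

noncomputable section

open scoped BigOperators Classical
open Set Metric Filter Topology
open Summit.AtomisticToContinuum.Crystallization.Theorems.ChartedPlanarOrderRigidityDoor (E3)
open Summit.AtomisticToContinuum.Crystallization.Theorems.ChartedPlanarOrderDensityDichotomy (μS IsSep)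
open Summit.AtomisticToContinuum.Crystallization.Theorems.ChartedPlanarOrderCleanScaleP (IsCleanP IsDoorSetP)
open Summit.AtomisticToContinuum.Crystallization.Theorems.ChartedPlanarOrderMesoCut (LayeredHom)
open Summit.AtomisticToContinuum.Crystallization.Theorems.ChartedPlanarOrderDoorLayeredOsc (IsTwoShellAffineGood)
open Literature.MathematicalPhysics.StatisticalMechanics (lennardJones interactionEnergy)

namespace Summit.AtomisticToContinuum.Crystallization.Theorems.ChartedZeroExcessLayeredLatticeLiouville

/-! ### YK-1  FREE CRITICALITY OF THE CORE (PROVED): on a separated single-site-Nash configuration with summable pair sums, every injectively enumerated finite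
region is a CRITICAL POINT of its clamped energy — so in (QSⁿ)/(QH) the mild core `xf` is itself clamped-critical, at no cost in binders -/

section CoreCritical

open Summit.AtomisticToContinuum.Crystallization.Theorems.ChartedPlanarOrderRigidityDoor (IsNash)
open Summit.AtomisticToContinuum.Crystallization.Theorems.ChartedPlanarOrderDoorLayeredOsc (mem_iff_μS_singleton_ne_zero)
open Summit.AtomisticToContinuum.Crystallization.Theorems.ChartedPlanarOrderNashForceBalance (hasFDerivAt_siteEnergy hasFDerivAt_pair summable_inv_pow_six)
open Literature.MathematicalPhysics.StatisticalMechanics (lennardJones_zero two_mul_interactionEnergy_eq_sum_sum)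

variable {δ : ℝ} {S : Set E3}

/-- set bookkeeping: `S ∖ {xf i} ⊆ (S ∖ range xf) ∪ range (xf ∘ i.succAbove)`. [this file, g66] -/
theorem sdiff_singleton_subset_union {S : Set E3} {m : ℕ} (xf : Fin (m + 1) → E3) (i : Fin (m + 1)) :
    S \ {xf i} ⊆ (S \ Set.range xf) ∪ Set.range (xf ∘ i.succAbove) := by
  intro q hq
  have hqS : q ∈ S := hq.1
  have hqi : q ≠ xf i := fun h => hq.2 (Set.mem_singleton_iff.2 h)
  by_cases hqr : q ∈ Set.range xf
  · obtain ⟨k, rfl⟩ := hqr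
    have hki : k ≠ i := fun h => hqi (congrArg xf h)
    obtain ⟨j, hj⟩ := Fin.exists_succAbove_eq_iff.2 hki
    exact Or.inr ⟨j, by simp only [Function.comp_apply, hj]⟩
  · exact Or.inl ⟨hqS, hqr⟩

/-- set bookkeeping: the converse inclusion, for an injective family inside `S`. [this file, g66] -/
theorem union_subset_sdiff_singleton {S : Set E3} {m : ℕ} {xf : Fin (m + 1) → E3} (hxf : Function.Injective xf)
    (hXS : Set.range xf ⊆ S) (i : Fin (m + 1)) :
    (S \ Set.range xf) ∪ Set.range (xf ∘ i.succAbove) ⊆ S \ {xf i} := by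
  intro q hq
  rcases hq with hq | ⟨j, rfl⟩
  · exact ⟨hq.1, fun h => hq.2 ⟨i, (Set.mem_singleton_iff.1 h).symm⟩⟩
  · exact ⟨hXS ⟨i.succAbove j, rfl⟩, fun h => Fin.succAbove_ne i j (hxf (Set.mem_singleton_iff.1 h))⟩

/-- the pair sum over `S ∖ {xf i}` splits into the frozen exterior `S ∖ range xf` and the other members of the family. [this file, g66] -/
theorem tsum_sdiff_singleton_eq_add (hsum : ∀ z : E3, Summable fun y : S => lennardJones (dist z (y : E3))) {m : ℕ}
    {xf : Fin (m + 1) → E3} (hxf : Function.Injective xf) (hXS : Set.range xf ⊆ S) (i : Fin (m + 1)) (z : E3) :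
    ∑' q : ↥(S \ {xf i}), lennardJones (dist z (q : E3)) =
      ∑' y : ↥(S \ Set.range xf), lennardJones (dist z (y : E3)) + ∑ j, lennardJones (dist z (xf (i.succAbove j))) := by
  have hd : Function.Injective (xf ∘ i.succAbove) := hxf.comp Fin.succAbove_right_injective
  have hset : S \ {xf i} = (S \ Set.range xf) ∪ Set.range (xf ∘ i.succAbove) :=
    Set.Subset.antisymm (sdiff_singleton_subset_union xf i) (union_subset_sdiff_singleton hxf hXS i)
  have hdisj : Disjoint (S \ Set.range xf) (Set.range (xf ∘ i.succAbove)) :=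
    Set.disjoint_left.2 fun q hq hq' => hq.2 (by obtain ⟨j, rfl⟩ := hq'; exact ⟨_, rfl⟩)
  have hsX : Summable fun y : ↥(S \ Set.range xf) => lennardJones (dist z (y : E3)) :=
    summable_coe_subset (f := fun w => lennardJones (dist z w)) Set.sdiff_subset (hsum z)
  have h1 : ∑' q : ↥(S \ {xf i}), lennardJones (dist z (q : E3)) =
      ∑' q : ↥((S \ Set.range xf) ∪ Set.range (xf ∘ i.succAbove)), lennardJones (dist z (q : E3)) :=
    tsum_congr_set_coe (fun q => lennardJones (dist z q)) hset
  have h2 := tsum_union_range_eq hd hdisj (fun q => lennardJones (dist z q)) hsX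
  rw [h1, h2]
  simp only [Function.comp_apply]

/-- the clamped energy with ONE member of the family displaced to `x`: the site terms of `x` plus an `x`-independent remainder. [this file, g66] -/
theorem clampedEnergy_update_eq {m : ℕ} (X : Set E3) (xf : Fin (m + 1) → E3) (i : Fin (m + 1)) (x : E3) :
    clampedEnergy X (Function.update xf i x) =
      (∑ j, lennardJones (dist x (xf (i.succAbove j))) + ∑' y : X, lennardJones (dist x (y : E3))) +
        (interactionEnergy lennardJones (xf ∘ i.succAbove) + ∑ j, ∑' y : X, lennardJones (dist (xf (i.succAbove j)) (y : E3))) := by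
  have h2 := two_mul_interactionEnergy_eq_sum_sum lennardJones lennardJones_zero (Function.update xf i x)
  have h2' := two_mul_interactionEnergy_eq_sum_sum lennardJones lennardJones_zero (xf ∘ i.succAbove)
  simp only [Fin.sum_univ_succAbove _ i, Function.update_self, ne_eq, Fin.succAbove_ne, not_false_eq_true,
    Function.update_of_ne, dist_self, lennardJones_zero, zero_add, Function.comp_apply, Finset.sum_add_distrib] at h2 h2'
  have hsym : ∑ j, lennardJones (dist (xf (i.succAbove j)) x) = ∑ j, lennardJones (dist x (xf (i.succAbove j))) :=
    Finset.sum_congr rfl fun j _ => by rw [dist_comm]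
  unfold clampedEnergy
  rw [Fin.sum_univ_succAbove _ i]
  simp only [Function.update_self, ne_eq, Fin.succAbove_ne, not_false_eq_true, Function.update_of_ne]
  linarith

/-- single-site Nash ⇒ each member of an enumerated finite region of `S` is a LOCAL MINIMISER of the clamped energy under its own displacement
(N's inequality, rewritten through part UH's set dictionary `tsum_nash_eq` and the splitting above). [this file, g66] -/
theorem isLocalMin_clampedEnergy_update (hδ : 0 < δ) (hsep : IsSep δ S) (hN : IsNash (μS S))
    (hsum : ∀ z : E3, Summable fun y : S => lennardJones (dist z (y : E3))) {m : ℕ} {xf : Fin (m + 1) → E3}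
    (hxf : Function.Injective xf) (hXS : Set.range xf ⊆ S) (i : Fin (m + 1)) :
    IsLocalMin (fun x : E3 => clampedEnergy (S \ Set.range xf) (Function.update xf i x)) (xf i) := by
  have hp : xf i ∈ S := hXS (Set.mem_range_self i)
  have hp' : μS S {xf i} ≠ 0 := (mem_iff_μS_singleton_ne_zero S (xf i)).2 hp
  refine Filter.eventually_of_mem (ball_mem_nhds (xf i) (half_pos hδ)) fun x hx => ?_
  have hy : ∀ q : E3, μS S {q} ≠ 0 → q ≠ xf i → x ≠ q := by
    intro q hq hqp hxq
    have hqS : q ∈ S := (mem_iff_μS_singleton_ne_zero S q).1 hq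
    have hd : δ ≤ dist (xf i) q := hsep (xf i) hp q hqS (Ne.symm hqp)
    rw [mem_ball, hxq, dist_comm] at hx
    linarith
  have hNash := hN (xf i) hp' x hy
  rw [tsum_nash_eq S (xf i) (xf i), tsum_nash_eq S (xf i) x, tsum_sdiff_singleton_eq_add hsum hxf hXS i (xf i),
    tsum_sdiff_singleton_eq_add hsum hxf hXS i x] at hNash
  show clampedEnergy (S \ Set.range xf) (Function.update xf i (xf i)) ≤ clampedEnergy (S \ Set.range xf) (Function.update xf i x)
  rw [clampedEnergy_update_eq, clampedEnergy_update_eq]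
  linarith

/-- a finite sum of pair terms against FIXED partners distinct from the base point is differentiable there. [this file, g66] -/
theorem differentiableAt_sum_pair {ι : Type*} (u : Finset ι) (c : ι → E3) {p : E3} (hp : ∀ j ∈ u, p ≠ c j) :
    DifferentiableAt ℝ (fun x : E3 => ∑ j ∈ u, lennardJones (dist x (c j))) p := by
  have key : ∀ j ∈ u, DifferentiableAt ℝ (fun x : E3 => lennardJones (dist x (c j))) p := by
    intro j hj
    have hfun : (fun x : E3 => lennardJones (dist x (c j))) = fun x => lennardJones ‖x - c j‖ := by
      funext x; rw [dist_eq_norm]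
    rw [hfun]
    exact (hasFDerivAt_pair (hp j hj)).differentiableAt
  have h := DifferentiableAt.sum key
  rwa [Finset.sum_fn] at h

/-- the exterior pair sum `x ↦ Σ'_{y ∈ S ∖ range xf} V(dist x y)` is differentiable at each member of the family (part N-force-balance's `hasFDerivAt_siteEnergy`
for the full site sum, minus the finitely many family terms). [this file, g66] -/
theorem differentiableAt_tsum_exterior (hδ : 0 < δ) (hsep : IsSep δ S)
    (hsum : ∀ z : E3, Summable fun y : S => lennardJones (dist z (y : E3))) {m : ℕ} {xf : Fin (m + 1) → E3}
    (hxf : Function.Injective xf) (hXS : Set.range xf ⊆ S) (i : Fin (m + 1)) :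
    DifferentiableAt ℝ (fun x : E3 => ∑' y : ↥(S \ Set.range xf), lennardJones (dist x (y : E3))) (xf i) := by
  have hp : xf i ∈ S := hXS (Set.mem_range_self i)
  have hsite : (fun x : E3 => ∑' y : ↥(S \ Set.range xf), lennardJones (dist x (y : E3))) = fun x =>
      ChartedPlanarOrderNashForceBalance.siteEnergy S (xf i) x - ∑ j, lennardJones (dist x (xf (i.succAbove j))) := by
    funext x
    rw [ChartedPlanarOrderNashForceBalance.siteEnergy, tsum_nash_eq S (xf i) x, tsum_sdiff_singleton_eq_add hsum hxf hXS i x]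
    ring
  rw [hsite]
  refine ((hasFDerivAt_siteEnergy hδ hsep hp (summable_inv_pow_six hδ hsep hp)).1.differentiableAt).sub ?_
  exact differentiableAt_sum_pair Finset.univ (fun j => xf (i.succAbove j)) fun j _ h => Fin.succAbove_ne i j (hxf h.symm)

/-- the clamped energy of an injectively enumerated finite region of a separated `S` (summable pair sums) is differentiable at the enumeration. [this file, g66] -/
theorem differentiableAt_clampedEnergy (hδ : 0 < δ) (hsep : IsSep δ S)
    (hsum : ∀ z : E3, Summable fun y : S => lennardJones (dist z (y : E3))) {m : ℕ} {xf : Fin (m + 1) → E3}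
    (hxf : Function.Injective xf) (hXS : Set.range xf ⊆ S) :
    DifferentiableAt ℝ (fun z : Fin (m + 1) → E3 => clampedEnergy (S \ Set.range xf) z) xf := by
  have hpair : ∀ j k : Fin (m + 1), DifferentiableAt ℝ (fun z : Fin (m + 1) → E3 => lennardJones (dist (z j) (z k))) xf := by
    intro j k
    by_cases hjk : j = k
    · subst hjk
      simp only [dist_self, lennardJones_zero]
      exact differentiableAt_const _
    · have hne : xf j - xf k ≠ (0 : E3) := sub_ne_zero.2 (hxf.ne hjk)
      have hfun : (fun z : Fin (m + 1) → E3 => lennardJones (dist (z j) (z k))) =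
          (fun u : E3 => lennardJones ‖u - 0‖) ∘ fun z : Fin (m + 1) → E3 => z j - z k := by
        funext z; simp [dist_eq_norm]
      rw [hfun]
      exact (hasFDerivAt_pair hne).differentiableAt.comp xf ((differentiableAt_apply (𝕜 := ℝ) j xf).sub (differentiableAt_apply (𝕜 := ℝ) k xf))
  have hint : DifferentiableAt ℝ (fun z : Fin (m + 1) → E3 => ∑ j, ∑ k, lennardJones (dist (z j) (z k))) xf := by
    have hrow : ∀ j ∈ (Finset.univ : Finset (Fin (m + 1))),
        DifferentiableAt ℝ (fun z : Fin (m + 1) → E3 => ∑ k, lennardJones (dist (z j) (z k))) xf := by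
      intro j _
      have h := DifferentiableAt.sum (u := Finset.univ) fun k _ => hpair j k
      rwa [Finset.sum_fn] at h
    have h := DifferentiableAt.sum hrow
    rwa [Finset.sum_fn] at h
  have hext : DifferentiableAt ℝ (fun z : Fin (m + 1) → E3 => ∑ j, ∑' y : ↥(S \ Set.range xf), lennardJones (dist (z j) (y : E3))) xf := by
    have hrow : ∀ j ∈ (Finset.univ : Finset (Fin (m + 1))),
        DifferentiableAt ℝ (fun z : Fin (m + 1) → E3 => ∑' y : ↥(S \ Set.range xf), lennardJones (dist (z j) (y : E3))) xf := by
      intro j _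
      exact (differentiableAt_tsum_exterior hδ hsep hsum hxf hXS j).comp xf (differentiableAt_apply (𝕜 := ℝ) j xf)
    have h := DifferentiableAt.sum hrow
    rwa [Finset.sum_fn] at h
  have hfun : (fun z : Fin (m + 1) → E3 => clampedEnergy (S \ Set.range xf) z) = fun z =>
      (1 / 2 : ℝ) * ∑ j, ∑ k, lennardJones (dist (z j) (z k)) + ∑ j, ∑' y : ↥(S \ Set.range xf), lennardJones (dist (z j) (y : E3)) := by
    funext z
    have h2 := two_mul_interactionEnergy_eq_sum_sum lennardJones lennardJones_zero z
    unfold clampedEnergy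
    linarith
  rw [hfun]
  exact (hint.const_mul _).add hext

/-- ★★ **FREE CRITICALITY (PROVED).**  On a `δ`-separated single-site-Nash configuration `S` with summable pair sums, EVERY injectively enumerated finite
region `xf` is a critical point of its clamped energy against the rest: `HasFDerivAt (clampedEnergy (S ∖ range xf)) 0 xf`.  Differentiability from N-force-balance's
`hasFDerivAt_siteEnergy` and the pair calculus; vanishing from single-site minimality (`isLocalMin_clampedEnergy_update`, `IsLocalMin.hasFDerivAt_eq_zero`)
tested on the coordinate directions `Pi.single i u`, which span.  No cleanliness, chart or tameness is used. [this file, g66] -/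
theorem hasFDerivAt_clampedEnergy_zero_of_isNash (hδ : 0 < δ) (hsep : IsSep δ S) (hN : IsNash (μS S))
    (hsum : ∀ z : E3, Summable fun y : S => lennardJones (dist z (y : E3))) {n : ℕ} {xf : Fin n → E3}
    (hxf : Function.Injective xf) (hXS : Set.range xf ⊆ S) :
    HasFDerivAt (fun z : Fin n → E3 => clampedEnergy (S \ Set.range xf) z) (0 : (Fin n → E3) →L[ℝ] ℝ) xf := by
  cases n with
  | zero =>
    have hconst : (fun z : Fin 0 → E3 => clampedEnergy (S \ Set.range xf) z) = fun _ => clampedEnergy (S \ Set.range xf) xf := by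
      funext z; rw [Subsingleton.elim z xf]
    rw [hconst]
    exact hasFDerivAt_const _ _
  | succ m =>
    have hL := (differentiableAt_clampedEnergy hδ hsep hsum hxf hXS).hasFDerivAt
    have hzero : ∀ (i : Fin (m + 1)) (u : E3),
        fderiv ℝ (fun z : Fin (m + 1) → E3 => clampedEnergy (S \ Set.range xf) z) xf (Pi.single i u) = 0 := by
      intro i u
      have hL' : HasFDerivAt (fun z : Fin (m + 1) → E3 => clampedEnergy (S \ Set.range xf) z)
          (fderiv ℝ (fun z : Fin (m + 1) → E3 => clampedEnergy (S \ Set.range xf) z) xf) (Function.update xf i (xf i)) := by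
        rw [Function.update_eq_self]; exact hL
      have hcomp := hL'.comp (xf i) (hasFDerivAt_update xf (xf i))
      have h0 := (isLocalMin_clampedEnergy_update hδ hsep hN hsum hxf hXS i).hasFDerivAt_eq_zero hcomp
      have hpi : (ContinuousLinearMap.pi (Pi.single i (ContinuousLinearMap.id ℝ E3))) u = (Pi.single i u : Fin (m + 1) → E3) := by
        funext j
        rw [ContinuousLinearMap.pi_apply]
        by_cases hj : j = i
        · subst hj; simp
        · simp [hj]
      have := DFunLike.congr_fun h0 u
      rw [ContinuousLinearMap.comp_apply, hpi] at this
      simpa using this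
    have hfd : fderiv ℝ (fun z : Fin (m + 1) → E3 => clampedEnergy (S \ Set.range xf) z) xf = 0 := by
      refine ContinuousLinearMap.ext fun v => ?_
      rw [← Finset.univ_sum_single v, map_sum]
      simp [hzero]
    rw [hfd] at hL
    exact hL

/-- ★★ **the (QSⁿ)/(QH) form (PROVED): under the docket's binders the mild CORE `xf` is ITSELF a clamped critical point** — `IsDoorSetP` carries single-site Nash
stationarity and separation, `range xf = coreOf S K ρ ⊆ S`.  (Moreover every core atom is a single-site MINIMISER of its site energy in `S` — N's binder — which a
stiffness certificate may also use.) [this file, g66] -/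
theorem hasFDerivAt_clampedEnergy_core {aHi δ ρ : ℝ} {S K : Set E3} (hδ : 0 < δ) (hS : IsDoorSetP aHi δ S)
    (hsum : ∀ z : E3, Summable fun y : S => lennardJones (dist z (y : E3))) {n : ℕ} {xf : Fin n → E3}
    (hxf : Function.Injective xf) (hrange : Set.range xf = coreOf S K ρ) :
    HasFDerivAt (fun z : Fin n → E3 => clampedEnergy (S \ coreOf S K ρ) z) (0 : (Fin n → E3) →L[ℝ] ℝ) xf := by
  have hXS : Set.range xf ⊆ S := hrange ▸ coreOf_subset S K ρ
  rw [← hrange]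
  exact hasFDerivAt_clampedEnergy_zero_of_isNash hδ hS.2.1 hS.2.2.2.1 hsum hxf hXS

end CoreCritical

/-! ### YK-2  THE DOUBLY-CRITICAL NEAR FLOOR: (QSⁿᶜ) `NearSecantFloorCritP` / (QHᶜ) `NearHessianFloorCritP` — (QSⁿ)/(QH) with the criticality of the CORE as an
explicit binder — and (QSⁿᶜ) ⇒ (QSⁿ), (QHᶜ) ⇒ (QH) PROVED by YK-1 (CRITIC-LEDGER row 1208 (b⁗)(ii): the certificate's class is that of RELAXED mild cores) -/

section DoublyCritical

/-- ★★★ **(QSⁿᶜ) «NearSecantFloorCritP ϑ ϑp q ρ rm dm R cN aHi Λ θ s» — THE NEAR SECANT FLOOR ABOUT DOUBLY-CRITICAL MATCHED SEGMENTS.**  (QSⁿ) `NearSecantFloorP`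
VERBATIM with ONE extra binder after the enumeration of the core: `HasFDerivAt (clampedEnergy (S ∖ core)) 0 xf` — the mild core ITSELF is a clamped critical point
(as the tame filling `y` is).  By YK-1 the extra binder is FREE under the others (`hasFDerivAt_clampedEnergy_core`), so `(QSⁿᶜ) ⇒ (QSⁿ)` (PROVED below) and the
two are equivalent in content; the point of typing it is CRITIC-LEDGER row 1208's CLASS-WIDTH FLAG: a certificate for the near floor may work in a neighbourhood of
RELAXED (clamped-critical, indeed single-site-minimal) `ϑp`-tame cores — the segment joins two critical points `dm`-close sitewise — rather than on the full
tolerance class of `ϑp`-tame enumerations.  FINITE-DIMENSIONAL · LOCAL · UNDECIDED · CERT-able · INSTRUMENTABLE («MildBorn(1/10)» with the ADV-QH rows of row 1208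
restricted to Nash-relaxed class members).
Why it might fail: as (QSⁿ) — a relaxed mild core and its relaxed tame filling joined by a segment along which the near energy is not `cN`-convex (two distinct
nearby clamped critical points of a locally stable crystal would need a soft collective mode at `≤ 2.5 %` strain); repair = `ϑp ↓` (part YG) or `(R, Rc) ↑`.
Sources: part YJ-C ((QSⁿ)); CRITIC-LEDGER row 1208 (b⁗)(ii); N-force-balance (`hasFDerivAt_siteEnergy`, `nash_force_balance`). [this file, g66] -/
def NearSecantFloorCritP (ϑ ϑp q ρ rm dm R cN aHi Λ θ s : ℝ) : Prop :=
  ∀ δ : ℝ, 0 < δ → ∀ a : ℝ, 0 < a →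
    ∀ S : Set E3, IsDoorSetP aHi δ S → (∀ z : E3, Summable fun y : S => lennardJones (dist z (y : E3))) →
      (∀ p ∈ S, IsTwoShellAffineGood θ S p) →
        ∀ (L : E3 ≃L[ℝ] E3) (w : ℤ → E3), IsEquilChart a s Λ L w →
          ∀ (x₀ : E3) (K : Set E3), K ⊆ S → (∀ k ∈ K, dist k x₀ ≤ q) →
            IsTameOn ϑp S (LayeredHom (L : E3 →L[ℝ] E3) w) (coreOf S K rm) →
              ∀ (n : ℕ) (xf : Fin n → E3), Function.Injective xf → Set.range xf = coreOf S K ρ →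
                HasFDerivAt (fun z : Fin n → E3 => clampedEnergy (S \ coreOf S K ρ) z) (0 : (Fin n → E3) →L[ℝ] ℝ) xf →
                  ∀ y : Fin n → E3, (∀ i, dist (xf i) (y i) ≤ dm) → Function.Injective y → Disjoint (Set.range y) (S \ coreOf S K ρ) →
                    HasFDerivAt (fun z : Fin n → E3 => clampedEnergy (S \ coreOf S K ρ) z) (0 : (Fin n → E3) →L[ℝ] ℝ) y →
                      (∀ i, IsTameStar ϑ ((S \ coreOf S K ρ) ∪ Set.range y) (LayeredHom (L : E3 →L[ℝ] E3) w) (y i)) →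
                        ∀ t : ℝ, 0 < t → t ≤ 1 →
                          cN / 2 * t ^ 2 * ∑ i, dist (xf i) (y i) ^ 2 ≤
                            secondDiff (fun τ => nearClampedEnergy (S \ coreOf S K ρ) x₀ R (segConf y xf τ)) t

/-- ★★ **(QSⁿᶜ) ⇒ (QSⁿ) (PROVED)** — the core's criticality binder is discharged by `hasFDerivAt_clampedEnergy_core`. [this file, g66] -/
theorem nearSecantFloorP_of_crit {ϑ ϑp q ρ rm dm R cN aHi Λ θ s : ℝ} (h : NearSecantFloorCritP ϑ ϑp q ρ rm dm R cN aHi Λ θ s) :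
    NearSecantFloorP ϑ ϑp q ρ rm dm R cN aHi Λ θ s := by
  intro δ hδ a ha S hS hsum hgood L w hLw x₀ K hKS hKq hmild n xf hxf hrange
  exact h δ hδ a ha S hS hsum hgood L w hLw x₀ K hKS hKq hmild n xf hxf hrange (hasFDerivAt_clampedEnergy_core hδ hS hsum hxf hrange)

/-- the converse `(QSⁿ) ⇒ (QSⁿᶜ)` (trivial: drop the binder) — the two statements are EQUIVALENT. [this file, g66] -/
theorem nearSecantFloorCritP_of {ϑ ϑp q ρ rm dm R cN aHi Λ θ s : ℝ} (h : NearSecantFloorP ϑ ϑp q ρ rm dm R cN aHi Λ θ s) :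
    NearSecantFloorCritP ϑ ϑp q ρ rm dm R cN aHi Λ θ s := by
  intro δ hδ a ha S hS hsum hgood L w hLw x₀ K hKS hKq hmild n xf hxf hrange _
  exact h δ hδ a ha S hS hsum hgood L w hLw x₀ K hKS hKq hmild n xf hxf hrange

/-- ★★ **(QHᶜ) «NearHessianFloorCritP ϑ ϑp q ρ rm dm R cN aHi Λ θ s» — THE NEAR HESSIAN FLOOR ABOUT DOUBLY-CRITICAL MATCHED SEGMENTS** — (QH) `NearHessianFloorP`
VERBATIM with the same extra binder (criticality of the core `xf`); the CERTIFICATE's native form on the relaxed class.  `(QHᶜ) ⇒ (QH)` PROVED below, whence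
`(QHᶜ) ⇒ (QSⁿ)` by part YJ-C.  Tags, risk and sources: as (QSⁿᶜ). [this file, g66] -/
def NearHessianFloorCritP (ϑ ϑp q ρ rm dm R cN aHi Λ θ s : ℝ) : Prop :=
  ∀ δ : ℝ, 0 < δ → ∀ a : ℝ, 0 < a →
    ∀ S : Set E3, IsDoorSetP aHi δ S → (∀ z : E3, Summable fun y : S => lennardJones (dist z (y : E3))) →
      (∀ p ∈ S, IsTwoShellAffineGood θ S p) →
        ∀ (L : E3 ≃L[ℝ] E3) (w : ℤ → E3), IsEquilChart a s Λ L w →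
          ∀ (x₀ : E3) (K : Set E3), K ⊆ S → (∀ k ∈ K, dist k x₀ ≤ q) →
            IsTameOn ϑp S (LayeredHom (L : E3 →L[ℝ] E3) w) (coreOf S K rm) →
              ∀ (n : ℕ) (xf : Fin n → E3), Function.Injective xf → Set.range xf = coreOf S K ρ →
                HasFDerivAt (fun z : Fin n → E3 => clampedEnergy (S \ coreOf S K ρ) z) (0 : (Fin n → E3) →L[ℝ] ℝ) xf →
                  ∀ y : Fin n → E3, (∀ i, dist (xf i) (y i) ≤ dm) → Function.Injective y → Disjoint (Set.range y) (S \ coreOf S K ρ) →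
                    HasFDerivAt (fun z : Fin n → E3 => clampedEnergy (S \ coreOf S K ρ) z) (0 : (Fin n → E3) →L[ℝ] ℝ) y →
                      (∀ i, IsTameStar ϑ ((S \ coreOf S K ρ) ∪ Set.range y) (LayeredHom (L : E3 →L[ℝ] E3) w) (y i)) →
                        ∃ g₁ g₂ : ℝ → ℝ,
                          (∀ τ : ℝ, 0 ≤ τ → τ ≤ 1 → HasDerivAt (fun τ' => nearClampedEnergy (S \ coreOf S K ρ) x₀ R (segConf y xf τ')) (g₁ τ) τ) ∧
                            (∀ τ : ℝ, 0 ≤ τ → τ ≤ 1 → HasDerivAt g₁ (g₂ τ) τ) ∧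
                              ∀ τ : ℝ, 0 ≤ τ → τ ≤ 1 → 2 * cN * ∑ i, dist (xf i) (y i) ^ 2 ≤ g₂ τ

/-- ★★ **(QHᶜ) ⇒ (QH) (PROVED).** [this file, g66] -/
theorem nearHessianFloorP_of_crit {ϑ ϑp q ρ rm dm R cN aHi Λ θ s : ℝ} (h : NearHessianFloorCritP ϑ ϑp q ρ rm dm R cN aHi Λ θ s) :
    NearHessianFloorP ϑ ϑp q ρ rm dm R cN aHi Λ θ s := by
  intro δ hδ a ha S hS hsum hgood L w hLw x₀ K hKS hKq hmild n xf hxf hrange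
  exact h δ hδ a ha S hS hsum hgood L w hLw x₀ K hKS hKq hmild n xf hxf hrange (hasFDerivAt_clampedEnergy_core hδ hS hsum hxf hrange)

/-- ★★ **(QHᶜ)(cN) ⇒ (QSⁿ)(cN) (PROVED)** — the certificate on the relaxed class feeds the ladder of part YJ-C directly. [this file, g66] -/
theorem nearSecantFloorP_of_hessianFloorCrit {ϑ ϑp q ρ rm dm R cN aHi Λ θ s : ℝ} (h : NearHessianFloorCritP ϑ ϑp q ρ rm dm R cN aHi Λ θ s) :
    NearSecantFloorP ϑ ϑp q ρ rm dm R cN aHi Λ θ s :=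
  nearSecantFloorP_of_hessianFloor (nearHessianFloorP_of_crit h)

end DoublyCritical

end Summit.AtomisticToContinuum.Crystallization.Theorems.ChartedZeroExcessLayeredLatticeLiouville

end
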